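import Mathlib
import Literature.NumberTheory.LFunctions.Zhang2022.Section14MeanSquareMajorant
import Literature.NumberTheory.LFunctions.Zhang2022.Section7MeanSquareLowerBound

/-!
# Zhang (2022) §14, (14.3) at (15.5) and (16.1): the exponent `9` is attained — lower bounds of order `(log X)^9` on the classes `b ≪ τ₂`, `b₁ ≪ τ₃`

Trunk T-ANT (NumberTheory/LFunctions). Y. Zhang, *Discrete mean estimates and the Landau–Siegel
zero*, arXiv:2211.02515v1 (2022) [Zhang2022LandauSiegel], §14 ((14.1)–(14.3), Proposition 14.1)
[p. 28 of the source], §15 ((15.2), (15.5)) [p. 30], §16 ((16.1)) [p. 33], with (2.10) [p. 4] and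
(2.13) [p. 5]. **Status of the source: an unrefereed manuscript, a claimed result under
adjudication** (cell pub-zhang: audit + repair census of arXiv:2211.02515; no claim about
Landau–Siegel). Sequel of `Zhang2022.Section14MeanSquareMajorant` (UPPER bounds, exponent `9`, at
the two Proposition 14.1 call sites) and of `Zhang2022.Section7MeanSquareLowerBound` (the LOWER
bound at (7.5)); cell ALT seat 3, `HOME/ALT-3.md` §B3, §G1, §L2 ("B14": the class-level mean-value
exponent is two-sided).

The companion `Section14MeanSquareMajorant` proves, for Zhang's `κ₁ = n^{-β₁} ∗ n^{-β₂} ∗ μ` and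
`κ₂ = n^{-β₁} ∗ μ` (`β_j = i b_j` purely imaginary, (2.13)),
`∑_{m≤X} |(κ₁ ∗ b)(m)|²/m ≤ C² · O_L(1) · (log X)^9` for EVERY `b` with `|b(n)| ≤ C τ₂(n)`
(the class of (15.2), `b(n) ≪ τ₂(n)`), and `∑_{m≤X} |(κ₂ ∗ b₁)(m)|²/m ≤ C² · O_L(1) · (log X)^9`
for EVERY `b₁` with `|b₁(n)| ≤ C τ₃(n)` (the class at (16.1)). This file proves the matching
LOWER bounds on the same classes, by the divisor-function witnesses `b = τ₂` and `b₁ = τ₃`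
themselves (`C = 1`):

  `∑_{m≤X} |(κ₁ ∗ τ₂)(m)|²/m ≥ c(L) (log X)^9`,  `∑_{m≤X} |(κ₂ ∗ τ₃)(m)|²/m ≥ c(L) (log X)^9`,
  `c(L) = e^{-(297+18L)}/(2·80⁹)`,

whenever `log X ≥ 80` and `(|b₁|+|b₂|) log X ≤ L`, resp. `|b₁| log X ≤ L`
(`sum_norm_kappa₁_conv_tau_sq_div_ge_of_le_log`, `sum_norm_kappa₂_conv_tau_sq_div_ge_of_le_log`),
and records the two-sided statements `sum_norm_kappa₁_conv_sq_div_two_sided` ((15.5)) and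
`sum_norm_kappa₂_conv_sq_div_two_sided` ((16.1)). With `Section7MeanSquareLowerBound` ((7.5) on the
class (7.2)) all three sites at which the cell's variant system MV-E reads a mean-square exponent
`k = 9` (`ExponentLayerMV`, `PartIFloorK9`; rows X-ALT3.14.03a/b) are two-sided on their classes:
a majorant `C² · O_L(1) · (log X)^k` holds there with `k = 9` and with no `k < 9`, so any further
saving at these steps must use structure of the coefficient sequences beyond the divisor-type
bounds (15.2)/(14.1). Nothing about the manuscript's theorems is asserted; the source's own
counts at these points are the upper bounds with `τ₅²` (exponent `25`) quoted in the companion's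
docstring.

## The argument

`κ₁ ∗ τ₂ = n^{-β₁} ∗ n^{-β₂} ∗ 𝟙` and `κ₂ ∗ τ₃ = n^{-β₁} ∗ 𝟙 ∗ 𝟙` (`μ ∗ 𝟙 = δ`, Mathlib
`ArithmeticFunction.coe_moebius_mul_coe_zeta`; `τ_j = 𝟙^{∗j}`, `conv_tau`) are multiplicative
with values `p^{-ib₁} + p^{-ib₂} + 1`, resp. `p^{-ib₁} + 2`, at primes: modulus `≤ 3` and within
`(∑|b_j|) log p` of `3` (`norm_powI_sub_one_le`), hence `9 − 6(∑|b_j|) log p ≤ |F(p)|² ≤ 9`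
(`nine_sub_six_mul_le_norm_sq`). The generic Euler-product lower bound
`Section7MeanSquareLowerBound.sum_norm_sq_div_ge` (squarefree restriction, Mertens II from below,
logarithmically weighted Rankin tail), packaged here once in `X` alone for `a = A = 9`
(`sum_norm_sq_div_ge_nine_of_le_log`, auxiliary scale `y = ⌊X^{1/40}⌋`), gives the claims. Numbers,
not adjectives: the constants are crude and not optimised; only the exponent `9` and the
`L`-dependence through `e^{-18L}` (against `e^{32L}` above) are asserted. In the source's
normalisation `X = P²`: `L = 6π` at (15.5) and `L = 2π` at (16.1) ((2.13), (2.10); companion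
docstring).

Scope (deliberately NOT here): as in the companions — Proposition 14.1 and its error terms, the
large-sieve/Hölder step, the supports (15.2)/(14.2) (the witnesses `τ₂`, `τ₃` are not supported on
the source's ranges; the classes decided are the ones on which the companion's majorants are
stated and on which the cell's exponent is read: all `b` with `|b| ≤ Cτ₂`, resp. `|b₁| ≤ Cτ₃`),
every other row of the cell. No statement about Theorems 1–2 of the source is made or implied,
and the cell's census (R8) is unchanged by this file.

## References

* [Zhang2022LandauSiegel] Y. Zhang, arXiv:2211.02515v1, §14 (14.1)–(14.3) p. 28; §15 (15.2), (15.5)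
  p. 30; §16 (16.1) p. 33; (2.10) p. 4; (2.13) p. 5.
* [HardyWright2008] G. H. Hardy, E. M. Wright, *An Introduction to the Theory of Numbers*, 6th ed.,
  OUP 2008, Thm 427 (§22.7, Mertens' second theorem) — through `Section7MeanSquareLowerBound`.

## Mathlib / tree

Used: `ArithmeticFunction.natCoe_mul`, `natCoe_one`, `natCoe_apply`, `zeta_apply_ne`,
`coe_moebius_mul_coe_zeta`, `mul_apply`, `Complex.norm_real`, `Complex.ofReal_natCast`; tree:
`Section7MeanSquareLowerBound.sum_norm_sq_div_ge`; `Section14MeanSquareMajorant.tau`, `tau_nonneg`,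
`kappa₁`, `kappa₂`, `sum_norm_kappa₁_conv_sq_div_le_of_mul_log_le`,
`sum_norm_kappa₂_conv_sq_div_le_of_mul_log_le`; `Section7MeanSquareMajorant.conv`, `powI`,
`isMultiplicative_powI`, `norm_powI_of_pos`, `norm_powI_sub_one_le`, `mul_apply_prime`,
`majorantConst`.
-/

noncomputable section

open Finset Real ArithmeticFunction

namespace Literature.NumberTheory.LFunctions.Zhang2022.MeanSquareMajorant

/-! ### Part 1. Two generic lemmas -/

/-- If `z ∈ ℂ` is within `t` of `3` then `|z|² ≥ 9 − 6t` (`|z| ≥ 3 − t` and `(3−t)² ≥ 9 − 6t`; for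
`t > 3` the bound is negative). [folklore] -/
theorem nine_sub_six_mul_le_norm_sq {z : ℂ} {t : ℝ} (ht : ‖z - 3‖ ≤ t) : 9 - 6 * t ≤ ‖z‖ ^ 2 := by
  have h3 : ‖(3 : ℂ)‖ = 3 := Complex.norm_ofNat 3
  have h := norm_sub_norm_le (3 : ℂ) z
  rw [h3, ← norm_sub_rev z 3] at h
  set x := ‖z‖ with hxdef
  have hx0 : 0 ≤ x := norm_nonneg _
  have ht0 : 0 ≤ t := le_trans (norm_nonneg _) ht
  have hx : 3 - t ≤ x := by linarith
  rcases le_or_gt t 3 with h3t | h3t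
  · nlinarith [mul_nonneg (sub_nonneg.2 hx) (by linarith : 0 ≤ x + (3 - t)), sq_nonneg t]
  · nlinarith [sq_nonneg x]

/-- **The Euler-product lower bound in `X` alone, for `a = A = 9`.** If `F` is multiplicative with
`9 − K log p ≤ |F(p)|² ≤ 9` at primes (`K ≥ 0`), `log X ≥ 80` and `K log X ≤ L`, then
`∑_{1≤m≤X} |F(m)|²/m ≥ e^{−(297+3L)}/(2·80⁹) · (log X)^9` — `sum_norm_sq_div_ge` at the auxiliary
scale `y = ⌊X^{1/40}⌋` (`log X/80 ≤ log y ≤ log X/40`). [folklore] -/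
theorem sum_norm_sq_div_ge_nine_of_le_log {F : ArithmeticFunction ℂ} (hF : F.IsMultiplicative)
    {K L : ℝ} (hK : 0 ≤ K) (hFA : ∀ p : ℕ, p.Prime → ‖F p‖ ^ 2 ≤ 9)
    (hFa : ∀ p : ℕ, p.Prime → 9 - K * Real.log p ≤ ‖F p‖ ^ 2) {Y : ℕ} (hY : 80 ≤ Real.log Y)
    (hL : K * Real.log Y ≤ L) :
    Real.exp (-(297 + 3 * L)) / (2 * 80 ^ 9) * Real.log Y ^ 9 ≤ ∑ m ∈ Icc 1 Y, ‖F m‖ ^ 2 / m := by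
  set r := Real.exp (Real.log Y / 40) with hr
  set y := ⌊r⌋₊ with hydef
  have hr0 : 0 < r := Real.exp_pos _
  have hr2 : (2 : ℝ) ≤ r := by
    have h2 : Real.log 2 ≤ Real.log Y / 40 := by linarith [Real.log_two_lt_d9]
    calc (2 : ℝ) = Real.exp (Real.log 2) := (Real.exp_log two_pos).symm
      _ ≤ r := Real.exp_le_exp.2 h2
  have hy2 : 2 ≤ y := Nat.le_floor (by exact_mod_cast hr2)
  have hyr : (y : ℝ) ≤ r := Nat.floor_le hr0.le
  have hy0 : (0 : ℝ) < y := by exact_mod_cast (show 0 < y by omega)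
  have hlogr : Real.log r = Real.log Y / 40 := by rw [hr, Real.log_exp]
  have hlogy_le : Real.log y ≤ Real.log Y / 40 := by
    rw [← hlogr]
    exact Real.log_le_log hy0 hyr
  have hlogy_ge : Real.log Y / 80 ≤ Real.log y := by
    have h1 : r < y + 1 := Nat.lt_floor_add_one r
    have h2 : r / 2 ≤ y := by linarith
    calc Real.log Y / 80 ≤ Real.log Y / 40 - Real.log 2 := by linarith [Real.log_two_lt_d9]
      _ = Real.log (r / 2) := by rw [Real.log_div hr0.ne' two_ne_zero, hlogr]
      _ ≤ Real.log y := Real.log_le_log (by linarith) h2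
  have hyY : 2 * 9 * (Real.log y + 2) ≤ Real.log Y := by linarith
  have hY2 : 2 ≤ Y := by
    by_contra h
    have hY1 : (Y : ℝ) ≤ 1 := by exact_mod_cast Nat.lt_succ_iff.1 (not_le.1 h)
    rcases Nat.eq_zero_or_pos Y with h0 | hpos
    · rw [h0, Nat.cast_zero, Real.log_zero] at hY
      linarith
    · have : Real.log Y ≤ Y - 1 := Real.log_le_sub_one_of_pos (by exact_mod_cast hpos)
      linarith
  have hLy : K * Real.log y ≤ L := by
    have : K * Real.log y ≤ K * Real.log Y := mul_le_mul_of_nonneg_left (by linarith) hK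
    linarith
  have h := sum_norm_sq_div_ge hF (a := 9) (A := 9) (K := K) (L := L) hK hFA
    (fun (p : ℕ) hp => by
      have := hFa p hp
      push_cast
      linarith) hy2 hY2 hyY hLy
  have hc : Real.exp (-(24 * ((9 : ℕ) : ℝ) + (9 : ℝ) ^ 2 + 3 * L)) =
      Real.exp (-(297 + 3 * L)) := by
    congr 1
    push_cast
    ring
  rw [hc] at h
  have hpow : (Real.log Y / 80) ^ 9 ≤ Real.log y ^ 9 :=
    pow_le_pow_left₀ (by linarith) hlogy_ge 9
  calc Real.exp (-(297 + 3 * L)) / (2 * 80 ^ 9) * Real.log Y ^ 9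
      = Real.exp (-(297 + 3 * L)) / 2 * (Real.log Y / 80) ^ 9 := by ring
    _ ≤ Real.exp (-(297 + 3 * L)) / 2 * Real.log y ^ 9 :=
        mul_le_mul_of_nonneg_left hpow (by positivity)
    _ ≤ _ := h

/-! ### Part 2. The divisor functions as complex sequences: the witnesses `τ_j` -/

/-- Coercion `ℕ → R` of arithmetic functions commutes with powers. [folklore] -/
theorem natCoe_pow' {R : Type*} [Semiring R] (f : ArithmeticFunction ℕ) (k : ℕ) :
    ((f ^ k : ArithmeticFunction ℕ) : ArithmeticFunction R) = (f : ArithmeticFunction R) ^ k := by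
  induction k with
  | zero => rw [pow_zero, pow_zero, natCoe_one]
  | succ k ih => rw [pow_succ, pow_succ, natCoe_mul, ih]

/-- `τ_j = ζ^j` computed in `ℕ` and then coerced. [folklore] -/
theorem tau_eq_natCoe_pow (j : ℕ) :
    tau j = (((ArithmeticFunction.zeta ^ j : ArithmeticFunction ℕ)) : ArithmeticFunction ℝ) := by
  rw [natCoe_pow']; rfl

/-- The witness `τ_j`, read as a complex sequence `n ↦ (τ_j(n) : ℂ)`, has `|τ_j(n)| = τ_j(n)`;
in the source `b = τ₂` lies in the class (15.2) `b ≪ τ₂` and `b₁ = τ₃` in the class `b₁ ≪ τ₃` of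
(16.1), both with constant `1` (`norm_tau_le_one_mul`). [folklore] -/
theorem norm_tau_ofReal (j n : ℕ) : ‖((tau j n : ℝ) : ℂ)‖ = tau j n := by
  rw [Complex.norm_real, Real.norm_of_nonneg (tau_nonneg j n)]

/-- `|τ_j(n)| ≤ 1 · τ_j(n)`: the witness lies in the class with constant `C = 1`. [folklore] -/
theorem norm_tau_le_one_mul (j n : ℕ) : ‖((tau j n : ℝ) : ℂ)‖ ≤ 1 * tau j n := by
  rw [norm_tau_ofReal, one_mul]

/-- `τ_j(n) = (𝟙^{∗j})(n)` as complex numbers. [folklore] -/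
theorem tau_ofReal_eq_pow_apply (j n : ℕ) :
    ((tau j n : ℝ) : ℂ) = ((ArithmeticFunction.zeta : ArithmeticFunction ℂ) ^ j) n := by
  rw [tau_eq_natCoe_pow, natCoe_apply, Complex.ofReal_natCast, ← natCoe_pow', natCoe_apply]

/-- `κ ∗ τ_j = κ ∗ 𝟙^{∗j}` pointwise. [folklore] -/
theorem conv_tau (κ : ArithmeticFunction ℂ) (j m : ℕ) :
    conv κ (fun n => (tau j n : ℂ)) m =
      (κ * (ArithmeticFunction.zeta : ArithmeticFunction ℂ) ^ j) m := by
  simp only [conv, mul_apply, tau_ofReal_eq_pow_apply]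

/-! ### Part 3. (15.5) from below on the class `b ≪ τ₂` -/

/-- `κ₁ ∗ τ₂ = n^{-β₁} ∗ n^{-β₂} ∗ 𝟙` (`μ ∗ 𝟙 = δ`). [folklore] -/
theorem kappa₁_mul_zeta_sq (b₁ b₂ : ℝ) :
    kappa₁ b₁ b₂ * (ArithmeticFunction.zeta : ArithmeticFunction ℂ) ^ 2 =
      powI b₁ * powI b₂ * (ArithmeticFunction.zeta : ArithmeticFunction ℂ) := by
  calc kappa₁ b₁ b₂ * (ArithmeticFunction.zeta : ArithmeticFunction ℂ) ^ 2
      = powI b₁ * powI b₂ * (ArithmeticFunction.zeta : ArithmeticFunction ℂ) *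
          ((ArithmeticFunction.moebius : ArithmeticFunction ℂ) *
            (ArithmeticFunction.zeta : ArithmeticFunction ℂ)) := by rw [kappa₁]; ring
    _ = powI b₁ * powI b₂ * (ArithmeticFunction.zeta : ArithmeticFunction ℂ) := by
        rw [coe_moebius_mul_coe_zeta, mul_one]

/-- `(n^{-β₁} ∗ n^{-β₂} ∗ 𝟙)(p) = p^{-ib₁} + p^{-ib₂} + 1` at a prime. [folklore] -/
theorem powI_mul_powI_mul_zeta_apply_prime (b₁ b₂ : ℝ) {p : ℕ} (hp : p.Prime) :
    (powI b₁ * powI b₂ * (ArithmeticFunction.zeta : ArithmeticFunction ℂ)) p =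
      powI b₁ p + powI b₂ p + 1 := by
  rw [mul_apply_prime ((isMultiplicative_powI b₁).mul (isMultiplicative_powI b₂)).map_one
      isMultiplicative_zeta.natCast.map_one hp,
    mul_apply_prime (isMultiplicative_powI b₁).map_one (isMultiplicative_powI b₂).map_one hp,
    natCoe_apply, zeta_apply_ne hp.ne_zero, Nat.cast_one]

/-- `|(κ₁ ∗ τ₂)(p)|² ≤ 9`. [folklore] -/
theorem norm_sq_powI₂_zeta_prime_le (b₁ b₂ : ℝ) {p : ℕ} (hp : p.Prime) :
    ‖(powI b₁ * powI b₂ * (ArithmeticFunction.zeta : ArithmeticFunction ℂ)) p‖ ^ 2 ≤ 9 := by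
  rw [powI_mul_powI_mul_zeta_apply_prime b₁ b₂ hp]
  have h : ‖powI b₁ p + powI b₂ p + 1‖ ≤ 3 := by
    calc ‖powI b₁ p + powI b₂ p + 1‖ ≤ ‖powI b₁ p‖ + ‖powI b₂ p‖ + ‖(1 : ℂ)‖ := norm_add₃_le
      _ = 3 := by rw [norm_powI_of_pos b₁ hp.pos, norm_powI_of_pos b₂ hp.pos, norm_one]; norm_num
  nlinarith [norm_nonneg (powI b₁ p + powI b₂ p + 1)]

/-- `|(κ₁ ∗ τ₂)(p)|² ≥ 9 − 6(|b₁|+|b₂|) log p` (`|p^{-ib_j} − 1| ≤ |b_j| log p`). [folklore] -/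
theorem norm_sq_powI₂_zeta_prime_ge (b₁ b₂ : ℝ) {p : ℕ} (hp : p.Prime) :
    9 - 6 * ((|b₁| + |b₂|) * Real.log p) ≤
      ‖(powI b₁ * powI b₂ * (ArithmeticFunction.zeta : ArithmeticFunction ℂ)) p‖ ^ 2 := by
  rw [powI_mul_powI_mul_zeta_apply_prime b₁ b₂ hp]
  apply nine_sub_six_mul_le_norm_sq
  have he : powI b₁ p + powI b₂ p + 1 - 3 = (powI b₁ p - 1) + (powI b₂ p - 1) := by ring
  rw [he]
  calc ‖(powI b₁ p - 1) + (powI b₂ p - 1)‖ ≤ ‖powI b₁ p - 1‖ + ‖powI b₂ p - 1‖ := norm_add_le _ _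
    _ ≤ |b₁| * Real.log p + |b₂| * Real.log p :=
        add_le_add (norm_powI_sub_one_le b₁ hp.pos) (norm_powI_sub_one_le b₂ hp.pos)
    _ = (|b₁| + |b₂|) * Real.log p := by ring

/-- **(15.5) from below.** For Zhang's `κ₁` (purely imaginary shifts `β_j = i b_j`) and the witness
`b = τ₂` (inside the class (15.2) `b ≪ τ₂`, constant `1`): if `log X ≥ 80` and
`(|b₁|+|b₂|) log X ≤ L` (in the source `X = P²`, `L = 6π` by (2.10), (2.13)), then
`∑_{1≤m≤X} |(κ₁ ∗ τ₂)(m)|²/m ≥ e^{−(297+18L)}/(2·80⁹) · (log X)^9`. The source's own count at this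
point is the UPPER bound with `τ₅²` [p. 28, p. 30]; nothing about the manuscript's theorems is
asserted. [cite: Zhang2022LandauSiegel, §15 (15.5), (15.2) p. 30 with §14 (14.1)–(14.3) p. 28] -/
theorem sum_norm_kappa₁_conv_tau_sq_div_ge_of_le_log (b₁ b₂ : ℝ) {L : ℝ} {Y : ℕ}
    (hY : 80 ≤ Real.log Y) (hL : (|b₁| + |b₂|) * Real.log Y ≤ L) :
    Real.exp (-(297 + 18 * L)) / (2 * 80 ^ 9) * Real.log Y ^ 9 ≤
      ∑ m ∈ Icc 1 Y, ‖conv (kappa₁ b₁ b₂) (fun n => (tau 2 n : ℂ)) m‖ ^ 2 / m := by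
  have hmult : (powI b₁ * powI b₂ *
      (ArithmeticFunction.zeta : ArithmeticFunction ℂ)).IsMultiplicative :=
    ((isMultiplicative_powI b₁).mul (isMultiplicative_powI b₂)).mul isMultiplicative_zeta.natCast
  have h := sum_norm_sq_div_ge_nine_of_le_log hmult (K := 6 * (|b₁| + |b₂|)) (L := 6 * L)
    (by positivity) (fun p hp => norm_sq_powI₂_zeta_prime_le b₁ b₂ hp)
    (fun p hp => by have := norm_sq_powI₂_zeta_prime_ge b₁ b₂ hp; linarith) hY (by linarith)
  have hc : Real.exp (-(297 + 3 * (6 * L))) = Real.exp (-(297 + 18 * L)) := by ring_nf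
  rw [hc] at h
  have e : ∀ m : ℕ, ‖conv (kappa₁ b₁ b₂) (fun n => (tau 2 n : ℂ)) m‖ ^ 2 / (m : ℝ) =
      ‖(powI b₁ * powI b₂ * (ArithmeticFunction.zeta : ArithmeticFunction ℂ)) m‖ ^ 2 / (m : ℝ) :=
    fun m => by rw [conv_tau, kappa₁_mul_zeta_sq]
  simp_rw [e]
  exact h

/-- **(15.5) is two-sided on the class `b ≪ τ₂`.** For Zhang's `κ₁`, `log X ≥ 80` and
`(|b₁|+|b₂|) log X ≤ L`:
(lower) the witness `b = τ₂` has `∑_{m≤X} |(κ₁ ∗ b)(m)|²/m ≥ e^{−(297+18L)}/(2·80⁹) (log X)^9`;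
(upper, the companion's `sum_norm_kappa₁_conv_sq_div_le_of_mul_log_le` at `C = 1`) EVERY `b` with
`|b(n)| ≤ τ₂(n)` (`n ≥ 1`) has `∑_{m≤X} |(κ₁ ∗ b)(m)|²/m ≤ majorantConst 9 10 · e^{32L} (log X)^9`.
So on the class (15.2) the exponent `9` of `log P²` recorded by the cell at (15.5) is exact (the
source prints `25`). Nothing about the manuscript's theorems is asserted.
[cite: Zhang2022LandauSiegel, §15 (15.5), (15.2) p. 30 with §14 (14.3) p. 28] -/
theorem sum_norm_kappa₁_conv_sq_div_two_sided (b₁ b₂ : ℝ) {L : ℝ} {Y : ℕ}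
    (hY : 80 ≤ Real.log Y) (hL : (|b₁| + |b₂|) * Real.log Y ≤ L) :
    Real.exp (-(297 + 18 * L)) / (2 * 80 ^ 9) * Real.log Y ^ 9 ≤
        ∑ m ∈ Icc 1 Y, ‖conv (kappa₁ b₁ b₂) (fun n => (tau 2 n : ℂ)) m‖ ^ 2 / m ∧
      ∀ b : ℕ → ℂ, (∀ n, n ≠ 0 → ‖b n‖ ≤ tau 2 n) →
        ∑ m ∈ Icc 1 Y, ‖conv (kappa₁ b₁ b₂) b m‖ ^ 2 / m ≤
          majorantConst 9 10 * Real.exp (32 * L) * Real.log Y ^ 9 := by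
  refine ⟨sum_norm_kappa₁_conv_tau_sq_div_ge_of_le_log b₁ b₂ hY hL, fun b hb => ?_⟩
  have hY4 : 4 ≤ Y := by
    by_contra h
    have hY3 : (Y : ℝ) ≤ 3 := by exact_mod_cast Nat.lt_succ_iff.1 (not_le.1 h)
    rcases Nat.eq_zero_or_pos Y with h0 | hpos
    · rw [h0, Nat.cast_zero, Real.log_zero] at hY
      linarith
    · have : Real.log Y ≤ Y - 1 := Real.log_le_sub_one_of_pos (by exact_mod_cast hpos)
      linarith
  have h := sum_norm_kappa₁_conv_sq_div_le_of_mul_log_le b₁ b₂ (C := 1)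
    (fun n hn => by rw [one_mul]; exact hb n hn) hY4 hL
  simpa using h

/-! ### Part 4. (16.1) from below on the class `b₁ ≪ τ₃` -/

/-- `κ₂ ∗ τ₃ = n^{-β₁} ∗ 𝟙 ∗ 𝟙` (`μ ∗ 𝟙 = δ`). [folklore] -/
theorem kappa₂_mul_zeta_cube (b₁ : ℝ) :
    kappa₂ b₁ * (ArithmeticFunction.zeta : ArithmeticFunction ℂ) ^ 3 =
      powI b₁ * (ArithmeticFunction.zeta : ArithmeticFunction ℂ) *
        (ArithmeticFunction.zeta : ArithmeticFunction ℂ) := by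
  calc kappa₂ b₁ * (ArithmeticFunction.zeta : ArithmeticFunction ℂ) ^ 3
      = powI b₁ * (ArithmeticFunction.zeta : ArithmeticFunction ℂ) *
          (ArithmeticFunction.zeta : ArithmeticFunction ℂ) *
          ((ArithmeticFunction.moebius : ArithmeticFunction ℂ) *
            (ArithmeticFunction.zeta : ArithmeticFunction ℂ)) := by rw [kappa₂]; ring
    _ = powI b₁ * (ArithmeticFunction.zeta : ArithmeticFunction ℂ) *
          (ArithmeticFunction.zeta : ArithmeticFunction ℂ) := by
        rw [coe_moebius_mul_coe_zeta, mul_one]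

/-- `(n^{-β₁} ∗ 𝟙 ∗ 𝟙)(p) = p^{-ib₁} + 2` at a prime. [folklore] -/
theorem powI_mul_zeta_mul_zeta_apply_prime (b₁ : ℝ) {p : ℕ} (hp : p.Prime) :
    (powI b₁ * (ArithmeticFunction.zeta : ArithmeticFunction ℂ) *
        (ArithmeticFunction.zeta : ArithmeticFunction ℂ)) p = powI b₁ p + 2 := by
  rw [mul_apply_prime ((isMultiplicative_powI b₁).mul isMultiplicative_zeta.natCast).map_one
      isMultiplicative_zeta.natCast.map_one hp,
    mul_apply_prime (isMultiplicative_powI b₁).map_one isMultiplicative_zeta.natCast.map_one hp,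
    natCoe_apply, zeta_apply_ne hp.ne_zero, Nat.cast_one]
  ring

/-- `|(κ₂ ∗ τ₃)(p)|² ≤ 9`. [folklore] -/
theorem norm_sq_powI_zeta_zeta_prime_le (b₁ : ℝ) {p : ℕ} (hp : p.Prime) :
    ‖(powI b₁ * (ArithmeticFunction.zeta : ArithmeticFunction ℂ) *
        (ArithmeticFunction.zeta : ArithmeticFunction ℂ)) p‖ ^ 2 ≤ 9 := by
  rw [powI_mul_zeta_mul_zeta_apply_prime b₁ hp]
  have h : ‖powI b₁ p + 2‖ ≤ 3 := by
    calc ‖powI b₁ p + 2‖ ≤ ‖powI b₁ p‖ + ‖(2 : ℂ)‖ := norm_add_le _ _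
      _ = 3 := by rw [norm_powI_of_pos b₁ hp.pos, Complex.norm_ofNat]; norm_num
  nlinarith [norm_nonneg (powI b₁ p + 2)]

/-- `|(κ₂ ∗ τ₃)(p)|² ≥ 9 − 6|b₁| log p`. [folklore] -/
theorem norm_sq_powI_zeta_zeta_prime_ge (b₁ : ℝ) {p : ℕ} (hp : p.Prime) :
    9 - 6 * (|b₁| * Real.log p) ≤
      ‖(powI b₁ * (ArithmeticFunction.zeta : ArithmeticFunction ℂ) *
        (ArithmeticFunction.zeta : ArithmeticFunction ℂ)) p‖ ^ 2 := by
  rw [powI_mul_zeta_mul_zeta_apply_prime b₁ hp]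
  apply nine_sub_six_mul_le_norm_sq
  have he : powI b₁ p + 2 - 3 = powI b₁ p - 1 := by ring
  rw [he]
  exact norm_powI_sub_one_le b₁ hp.pos

/-- **(16.1) from below.** For Zhang's `κ₂` (`β₁ = i b₁`) and the witness `b₁ = τ₃` (inside the
class `b₁ ≪ τ₃` of (16.1), constant `1`): if `log X ≥ 80` and `|b₁| log X ≤ L` (in the source
`X = P²`, `L = 2π`), then `∑_{1≤m≤X} |(κ₂ ∗ τ₃)(m)|²/m ≥ e^{−(297+18L)}/(2·80⁹) · (log X)^9`.
Nothing about the manuscript's theorems is asserted.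
[cite: Zhang2022LandauSiegel, §16 (16.1) p. 33 with §14 (14.1)–(14.3) p. 28] -/
theorem sum_norm_kappa₂_conv_tau_sq_div_ge_of_le_log (b₁ : ℝ) {L : ℝ} {Y : ℕ}
    (hY : 80 ≤ Real.log Y) (hL : |b₁| * Real.log Y ≤ L) :
    Real.exp (-(297 + 18 * L)) / (2 * 80 ^ 9) * Real.log Y ^ 9 ≤
      ∑ m ∈ Icc 1 Y, ‖conv (kappa₂ b₁) (fun n => (tau 3 n : ℂ)) m‖ ^ 2 / m := by
  have hmult : (powI b₁ * (ArithmeticFunction.zeta : ArithmeticFunction ℂ) *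
      (ArithmeticFunction.zeta : ArithmeticFunction ℂ)).IsMultiplicative :=
    ((isMultiplicative_powI b₁).mul isMultiplicative_zeta.natCast).mul isMultiplicative_zeta.natCast
  have h := sum_norm_sq_div_ge_nine_of_le_log hmult (K := 6 * |b₁|) (L := 6 * L)
    (by positivity) (fun p hp => norm_sq_powI_zeta_zeta_prime_le b₁ hp)
    (fun p hp => by have := norm_sq_powI_zeta_zeta_prime_ge b₁ hp; linarith) hY (by linarith)
  have hc : Real.exp (-(297 + 3 * (6 * L))) = Real.exp (-(297 + 18 * L)) := by ring_nf
  rw [hc] at h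
  have e : ∀ m : ℕ, ‖conv (kappa₂ b₁) (fun n => (tau 3 n : ℂ)) m‖ ^ 2 / (m : ℝ) =
      ‖(powI b₁ * (ArithmeticFunction.zeta : ArithmeticFunction ℂ) *
        (ArithmeticFunction.zeta : ArithmeticFunction ℂ)) m‖ ^ 2 / (m : ℝ) :=
    fun m => by rw [conv_tau, kappa₂_mul_zeta_cube]
  simp_rw [e]
  exact h

/-- **(16.1) is two-sided on the class `b₁ ≪ τ₃`.** For Zhang's `κ₂`, `log X ≥ 80` and
`|b₁| log X ≤ L`:
(lower) the witness `b₁ = τ₃` has `∑_{m≤X} |(κ₂ ∗ b₁)(m)|²/m ≥ e^{−(297+18L)}/(2·80⁹) (log X)^9`;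
(upper, the companion's `sum_norm_kappa₂_conv_sq_div_le_of_mul_log_le` at `C = 1`) EVERY `b₁` with
`|b₁(n)| ≤ τ₃(n)` (`n ≥ 1`) has
`∑_{m≤X} |(κ₂ ∗ b₁)(m)|²/m ≤ majorantConst 9 10 · e^{32L} (log X)^9`.
So on that class the exponent `9` of `log P²` recorded by the cell at (16.1) is exact (the source
prints `25`). Nothing about the manuscript's theorems is asserted.
[cite: Zhang2022LandauSiegel, §16 (16.1) p. 33 with §14 (14.3) p. 28] -/
theorem sum_norm_kappa₂_conv_sq_div_two_sided (b₁ : ℝ) {L : ℝ} {Y : ℕ}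
    (hY : 80 ≤ Real.log Y) (hL : |b₁| * Real.log Y ≤ L) :
    Real.exp (-(297 + 18 * L)) / (2 * 80 ^ 9) * Real.log Y ^ 9 ≤
        ∑ m ∈ Icc 1 Y, ‖conv (kappa₂ b₁) (fun n => (tau 3 n : ℂ)) m‖ ^ 2 / m ∧
      ∀ w : ℕ → ℂ, (∀ n, n ≠ 0 → ‖w n‖ ≤ tau 3 n) →
        ∑ m ∈ Icc 1 Y, ‖conv (kappa₂ b₁) w m‖ ^ 2 / m ≤
          majorantConst 9 10 * Real.exp (32 * L) * Real.log Y ^ 9 := by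
  refine ⟨sum_norm_kappa₂_conv_tau_sq_div_ge_of_le_log b₁ hY hL, fun w hw => ?_⟩
  have hY4 : 4 ≤ Y := by
    by_contra h
    have hY3 : (Y : ℝ) ≤ 3 := by exact_mod_cast Nat.lt_succ_iff.1 (not_le.1 h)
    rcases Nat.eq_zero_or_pos Y with h0 | hpos
    · rw [h0, Nat.cast_zero, Real.log_zero] at hY
      linarith
    · have : Real.log Y ≤ Y - 1 := Real.log_le_sub_one_of_pos (by exact_mod_cast hpos)
      linarith
  have h := sum_norm_kappa₂_conv_sq_div_le_of_mul_log_le b₁ (C := 1)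
    (fun n hn => by rw [one_mul]; exact hw n hn) hY4 hL
  simpa using h

end Literature.NumberTheory.LFunctions.Zhang2022.MeanSquareMajorant
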